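import Literature.AlgebraicGeometry.Resolution.PatchingMorphismStep
import Literature.AlgebraicGeometry.Resolution.RationalFunctionsToProjectiveSpaceConverse
import Literature.AlgebraicGeometry.Resolution.RegularCentreBlowupSeqExtensionIso
import Literature.AlgebraicGeometry.Resolution.FundamentalLocus
import HarnessLib

/-!
# Zariski–Piltant patching, Step 5: patching two models along a morphism without bad curves

Topic: `Literature/AlgebraicGeometry/Resolution`. The last step of the proof of Piltant 2013,
Prop. 5.1 (Zariski's patching of two projective models), for the usual regularity property
`P = P_reg`, with Axiom 4 := Cossart–Piltant's principalization (the HYPOTHESIS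
`hP : CossartPiltant2019Principalization`, as in `PatchingMorphismStep.lean`):

> Piltant 2013, proof of Prop. 5.1, Step 5 (p. 116): "Since there is no bad `x'` for `Σ'₁`, any
> irreducible component of `F_{η'}` is either identically contained in `f₁⁻¹(Reg_P(X₁))` or is
> contained in `Σ'₁`. Let `F₁ := F_{η'} ∩ f₁⁻¹(Reg_P X₁)`, `U₁ := X'₁ ∖ F₁` and
> `U₂ := f₁⁻¹(Reg_P X₁)` … By axiom 4 and (i), there exists a birational projective morphism
> `ε : Y₁ → X'₁` such that `𝓘𝒪_{ε⁻¹(U₂)}` is locally principal and `ε⁻¹(U₂) ⊆ Reg_P(Y₁)` and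
> `ε⁻¹(U) ≃ U` … `V₁` and `V₂` glue along `ε⁻¹(U) ≃ η'⁻¹(U)` to a proper model `Y/k` of `K` … `Y`
> satisfies the conclusion of the proposition."

Setting: `η : B → A` a morphism of projective models of `K/k`, a non-empty open `U₂ ⊆ Reg A`
(Piltant's `U₂ = f₁⁻¹(Reg_P X₁)`) carrying Piltant's Axiom 4 for `P = P_reg` (in dimension three
supplied by `hP`), such that **no point of indeterminacy of `A ⋯→ B` inside `U₂` specialises out
of `U₂`** (`closure (Ind ∩ U₂) ⊆ U₂`, `Ind = {a | 𝒪_{A,a}` has no centre on `B}`; Piltant's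
"there exists no bad `x`"). Conclusion (`ProjModel.exists_regLe_pair_of_closure_subset`): a
projective model `Y` dominating `A` and `B` with `ψ_A⁻¹(U₂) ⊆ Reg Y` and `ψ_B⁻¹(Reg B) ⊆ Reg Y`;
the case `U₂ = Reg A` with the hypothesis on the fundamental locus `F_η ⊇ Ind` of `η⁻¹` is
`ProjModel.exists_regLe_pair_of_closure_fundamentalLocus_subset`. The gluing of
the printed proof is replaced by the join (closure of the graph): `Y = J(A″, B)` where
`ρ : A″ → A` principalizes, on `Reg A`, the base ideal of the rational map `A ⋯→ B ⊆ ℙⁿ`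
(`CossartPiltant2019Principalization` + `IsRegularCentreBlowupSeq.exists_extension_full`); `Y`
is `A″` over the open where `A″ ⋯→ B` is defined (⊇ `ρ⁻¹(Reg A)`, regular) and is `B` over
`η⁻¹(P)`, `P = A ∖ closure (F_η ∩ Reg A) ⊇ Sing A`, where `ρ` is an isomorphism. PROVED here:

* `ProjModel.isDefinedAt_of_isIso_morphismRestrict` — the rational map `A ⋯→ B ⊆ ℙⁿ` is defined
  wherever `η : B → A` is a local isomorphism; `ProjModel.not_isDefinedAt_subset_fundamentalLocus`,
  `ProjModel.not_hasCentre_subset_fundamentalLocus`;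
* `ProjModel.exists_regLe_pair_of_closure_subset` — **Step 5** over an open `U₂ ⊆ Reg A`;
  `ProjModel.exists_regLe_pair_of_closure_fundamentalLocus_subset` (`U₂ = Reg A`),
  `ProjModel.exists_regLe_pair_of_principalization` (dimension three).

## References

* O. Piltant, RACSAM 107 (2013), Prop. 5.1, proof, Step 5; Lemma 3.3. [Piltant2013]
* O. Zariski, Ann. of Math. 45 (1944), Fundamental theorem p. 539 (via Piltant).
* V. Cossart, O. Piltant, J. Algebra 529 (2019), Prop. 4.4 and proof of Prop. 4.6, Step 3.
  [CossartPiltant2019]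
-/

noncomputable section

open CategoryTheory CategoryTheory.Limits AlgebraicGeometry TopologicalSpace IsLocalRing
open Literature.AlgebraicGeometry.Motives
open MvPolynomial HomogeneousLocalization

universe u

namespace Literature.AlgebraicGeometry.Resolution

attribute [local instance] MvPolynomial.gradedAlgebra

namespace ProjModel

variable {k K : Type u} [Field k] [Field K] [Algebra k K]

/-! ## The rational map `A ⋯→ B ⊆ ℙⁿ` is defined where `η : B → A` is a local isomorphism -/

section RationalInverse

variable (A B : ProjModel k K) {n : ℕ} (ιB : B.X ⟶ Proj (Segre.grading (Fin (n + 1)) k))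
  (w : Fin (n + 1) → K) (hw : w ≠ 0)
  (hgenB : B.gen ≫ ιB = (ProjectiveSpace.pointOfVec k w hw).left)
  (η : B.Hom A) (V : A.X.Opens) (hVne : (V : Set A.X).Nonempty) [IsIso (η.f ∣_ V)]

/-- The `K`-point of `B` is the lift of `gen_A` through `η⁻¹(V) ≅ V` (both lie over `gen_A` inside
`η⁻¹(V)`, over which `η` is an isomorphism). [folklore] -/
theorem gen_eq_genOfModification : B.gen = genOfModification A η.f V hVne := by
  have hrange : Set.range B.gen ⊆ Set.range (η.f ⁻¹ᵁ V).ι := by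
    rw [Scheme.Opens.range_ι, range_gen]
    rintro _ rfl
    show η.f (genericPoint B.X) ∈ V
    rw [← B.genericPt_eq, ← Scheme.Hom.comp_apply, η.gen_f, A.genericPt_eq]
    exact A.genericPoint_mem hVne
  let g' : Spec (CommRingCat.of K) ⟶ ↑(η.f ⁻¹ᵁ V) := IsOpenImmersion.lift (η.f ⁻¹ᵁ V).ι B.gen hrange
  have hg' : g' ≫ (η.f ⁻¹ᵁ V).ι = B.gen := IsOpenImmersion.lift_fac _ _ _
  have hg'V : g' ≫ (η.f ∣_ V) = A.genLift hVne := by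
    rw [← cancel_mono V.ι, Category.assoc, morphismRestrict_ι, ← Category.assoc, hg', η.gen_f,
      genLift_ι]
  rw [genOfModification, invOver, ← hg'V, Category.assoc, IsIso.hom_inv_id_assoc, hg']

include hgenB η hVne in
/-- **The rational map `A ⋯→ B ⊆ ℙⁿ_k` (homogeneous coordinates `w` of `gen_B`, read in
`K(A) ≅ K`) is defined at every point of an open `V ⊆ A` over which `η : B → A` is an
isomorphism** — there it is the morphism `V ≅ η⁻¹(V) ⊆ B ⊆ ℙⁿ_k`
(`isDefinedAt_of_comp_eq_pointOfVec`, transported back along the open immersion `V ↪ A`).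
[cite: Piltant2013, Lemma 3.3] -/
theorem isDefinedAt_of_isIso_morphismRestrict {a : A.X} (ha : a ∈ V) :
    IsDefinedAt (fun l => A.funFieldAlgEquiv.symm (w l)) a := by
  have hgenV : A.genLift hVne ≫ invOver A η.f V = B.gen := by
    rw [gen_eq_genOfModification A B η V hVne]; rfl
  exact isDefinedAt_of_hom A B ιB w hw hgenB V hVne (invOver A η.f V) hgenV ha

include hgenB in
/-- **The indeterminacy locus of `A ⋯→ B` lies in the fundamental locus of `η⁻¹`.**
[cite: Piltant2013, proof of Prop. 5.1, Step 3] -/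
theorem not_isDefinedAt_subset_fundamentalLocus :
    {a : A.X | ¬ IsDefinedAt (fun l => A.funFieldAlgEquiv.symm (w l)) a} ⊆ η.f.fundamentalLocus := by
  intro a ha
  by_contra hF
  have hmem : a ∈ η.f.isoLocus := by
    by_contra h; exact hF h
  obtain ⟨U₀, hU₀, hiso, -⟩ := η.exists_isIso_morphismRestrict
  haveI := hiso
  haveI := isIso_morphismRestrict_isoLocus η.f
  have hne : ((η.f.isoLocus : A.X.Opens) : Set A.X).Nonempty :=
    hU₀.mono (le_isoLocus η.f U₀)
  exact ha (isDefinedAt_of_isIso_morphismRestrict A B ιB w hw hgenB η η.f.isoLocus hne hmem)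

end RationalInverse

/-- **The intrinsic indeterminacy locus of `A ⋯→ B` (points whose local ring has no centre on `B`)
lies in the fundamental locus of `η⁻¹`** for any morphism of models `η : B → A`.
[cite: Piltant2013, proof of Prop. 5.1, Step 3] -/
theorem not_hasCentre_subset_fundamentalLocus (A B : ProjModel k K) (η : B.Hom A) :
    {a : A.X | ¬ B.HasCentre (A.stalkSubring a)} ⊆ η.f.fundamentalLocus := by
  intro a ha
  by_contra hF
  have hiso : a ∈ η.f.isoLocus := by
    by_contra h; exact hF h
  obtain ⟨V, haV, hV⟩ := (mem_isoLocus_iff η.f).mp hiso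
  haveI := hV
  -- a preimage `b` of `a` under the isomorphism `η⁻¹(V) ≅ V`
  obtain ⟨y, hy⟩ := (η.f ∣_ V).surjective ⟨a, haV⟩
  let b : B.X := (η.f ⁻¹ᵁ V).ι y
  have hb : η.f b = a := by
    have h1 : V.ι ((η.f ∣_ V) y) = a := by rw [hy]; rfl
    rw [← h1]
    change ((η.f ⁻¹ᵁ V).ι ≫ η.f) y = ((η.f ∣_ V) ≫ V.ι) y
    rw [morphismRestrict_ι]
  haveI := isIso_stalkMap_of_isIso_morphismRestrict η.f V b (by rw [hb]; exact haV)
  exact ha (hb ▸ hasCentre_of_isIso_stalkMap η b)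

/-! ## Step 5 -/

/-- **Zariski–Piltant patching, Step 5, over an open of the regular locus** (Piltant 2013, proof
of Prop. 5.1, Step 5, for `P = P_reg`, the gluing replaced by the join): let `η : B → A` be a
morphism of projective models of `K/k` and `U₂ ⊆ Reg A` a non-empty open (Piltant's
`U₂ = f₁⁻¹(Reg_P X₁)`) such that the closure of `Ind ∩ U₂` stays inside `U₂`, where `Ind` is the
set of points of `A` whose local ring has no centre on `B` (the indeterminacy locus of `A ⋯→ B`;
"there exists no bad `x`"). If every non-zero ideal sheaf on `U₂` is principalized by blowing ups
along regular centres in the non-locally-principal loci (Piltant's Axiom 4 for `P = P_reg`,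
hypothesis `hPr`; in dimension three: `CossartPiltant2019Principalization`), there is a projective
model `Y` of `K/k` with morphisms of models `ψ_A : Y → A`, `ψ_B : Y → B` such that
`ψ_A⁻¹(U₂) ⊆ Reg Y` and `ψ_B⁻¹(Reg B) ⊆ Reg Y`. [cite: Piltant2013, Prop. 5.1 (proof, Step 5)] -/
theorem exists_regLe_pair_of_closure_subset (A B : ProjModel k K) (η : B.Hom A) (U : A.X.Opens)
    (hU : (U : Set A.X) ⊆ Scheme.regularLocus A.X) (hUne : (U : Set A.X).Nonempty)
    (hPr : ∀ J : (U : Scheme.{u}).IdealSheafData, J ≠ ⊥ →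
        ∃ (S' : Scheme.{u}) (σ : S' ⟶ U), IsRegularCentreBlowupSeq σ J ∧
          IsLocallyPrincipal (J.comap σ))
    (hnb : closure ({a : A.X | ¬ B.HasCentre (A.stalkSubring a)} ∩ (U : Set A.X)) ⊆ U) :
    ∃ (Y : ProjModel k K) (ψA : Y.Hom A) (ψB : Y.Hom B),
      (∀ y : Y.X, ψA.f y ∈ U → IsRegularLocalRing (Y.X.presheaf.stalk y)) ∧ ψB.RegLe := by
  classical
  /- (1) a projective embedding `ιB : B ↪ ℙⁿ_k` and homogeneous coordinates `w` of `gen_B` -/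
  obtain ⟨n, ιB', hιB'⟩ := B.isProjectiveOver
  let ιB : B.X ⟶ Proj (Segre.grading (Fin (n + 1)) k) := ιB'.left
  haveI : IsClosedImmersion ιB := hιB'
  have hιBw : ιB ≫ Segre.toSpec (Fin (n + 1)) k = B.π := Over.w ιB'
  let P₁ : AlgPoints (projectiveSpace n k) K := genOver B ≫ ιB'
  obtain ⟨w, hw, hPw⟩ := ProjectiveSpace.exists_eq_pointOfVec (k := k) (L := K) P₁
  have hgenB : B.gen ≫ ιB = (ProjectiveSpace.pointOfVec k w hw).left := by
    rw [← hPw]; rfl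
  /- (2) the rational map `A ⋯→ B` -/
  let z : Fin (n + 1) → A.X.functionField := fun l => A.funFieldAlgEquiv.symm (w l)
  have hz : z ≠ 0 := ProjectiveSpace.algHom_comp_ne_zero A.funFieldAlgEquiv.symm.toAlgHom hw
  have hz' : ∃ i, z i ≠ 0 := by
    by_contra h
    push Not at h
    exact hz (funext h)
  have hInd : {a : A.X | ¬ IsDefinedAt z a} = {a : A.X | ¬ B.HasCentre (A.stalkSubring a)} := by
    ext a
    simp only [Set.mem_setOf_eq, hasCentre_stalkSubring_iff_isDefinedAt A B ιB hιBw w hw hgenB a]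
    rfl
  /- (3) the regular open `U` -/
  haveI : Nonempty (U : Scheme.{u}) := hUne.to_subtype
  haveI hintU : IsIntegral (U : Scheme.{u}) := isIntegral_of_isOpenImmersion U.ι
  have hregU : Scheme.IsRegular (U : Scheme.{u}) := fun x => by
    have hx : (U.ι x) ∈ Scheme.regularLocus A.X := hU (by rw [Scheme.Opens.ι_apply]; exact x.2)
    haveI : IsRegularLocalRing (A.X.presheaf.stalk (U.ι x)) := hx
    exact IsRegularLocalRing.of_ringEquiv (asIso (U.ι.stalkMap x)).commRingCatIsoToRingEquiv
  /- (4) the base ideal on `U` and its principalization, extended to `A` with its iso locus -/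
  let J : (U : Scheme.{u}).IdealSheafData := (baseIdeal z).comap U.ι
  have hJ : J ≠ ⊥ := by
    intro hbot
    let y : (U : Scheme.{u}) := Classical.arbitrary _
    have h1 : stalkIdeal J y = ⊥ := by rw [hbot, stalkIdeal_bot]
    rw [stalkIdeal_comap_of_isOpenImmersion] at h1
    obtain ⟨b, hb, hb0⟩ := (Submodule.ne_bot_iff _).mp (stalkIdeal_baseIdeal_ne_bot hz' (U.ι y))
    apply hb0
    have hb' : (U.ι.stalkMap y).hom b ∈
        (stalkIdeal (baseIdeal z) (U.ι y)).map (U.ι.stalkMap y).hom := Ideal.mem_map_of_mem _ hb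
    rw [h1, Ideal.mem_bot] at hb'
    exact (asIso (U.ι.stalkMap y)).commRingCatIsoToRingEquiv.injective
      (hb'.trans (map_zero _).symm)
  obtain ⟨S', σ, hσ, hprinc⟩ := hPr J hJ
  obtain ⟨X', ρ, j', hj', hpb, hprop, hint', hbir, hproj, hregS', hover, hisoP⟩ :=
    hσ.exists_extension_full hregU hJ U.ι
  haveI := hj'
  haveI := hint'
  haveI := hprop
  haveI := hisoP
  haveI : IsLocallyNoetherian X' := LocallyOfFiniteType.isLocallyNoetherian ρ
  haveI : IsIntegral S' := hσ.isIntegral hJ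
  /- (5) the open `P = A ∖ closure (Ind ∩ U)` over which `ρ` is an isomorphism contains `A ∖ U`
    (no bad points) and the generic point -/
  let P : A.X.Opens := principalOpen U.ι J
  have hFsub : closure (U.ι '' (nonPrincipalLocus J : Set U)) ⊆
      closure ({a : A.X | ¬ B.HasCentre (A.stalkSubring a)} ∩ (U : Set A.X)) := by
    refine closure_mono ?_
    rintro _ ⟨u, hu, rfl⟩
    refine ⟨?_, by rw [Scheme.Opens.ι_apply]; exact u.2⟩
    rw [← hInd]
    exact fun hdef => hu ((isLocallyPrincipalAt_baseIdeal hdef).comap U.ι)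
  have hPsing : ∀ a : A.X, a ∉ (U : Set A.X) → a ∈ P := by
    intro a haU hamem
    exact haU (hnb (hFsub hamem))
  have hPne : (P : Set A.X).Nonempty := by
    refine ⟨genericPoint A.X, fun hmem => ?_⟩
    let O : Set A.X := U.ι '' ((nonPrincipalLocus J : Set U)ᶜ)
    have hO : IsOpen O :=
      U.ι.isOpenEmbedding.isOpenMap _ (nonPrincipalLocus J).isClosed.isOpen_compl
    have hξO : genericPoint A.X ∈ O :=
      ⟨genericPoint U, genericPoint_not_mem_nonPrincipalLocus hJ,
        genericPoint_eq_of_isOpenImmersion U.ι⟩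
    obtain ⟨_, ⟨u, hu, rfl⟩, ⟨u', hu', he⟩⟩ := mem_closure_iff.mp hmem O hO hξO
    exact hu (U.ι.isOpenEmbedding.injective he ▸ hu')
  /- (6) `X'` as a projective model `A''` dominating `A`, regular over `U` -/
  have hprojρ : Motives.IsProjectiveOver (Over.mk (ρ ≫ A.π) : Motives.SchemeOver k) :=
    hproj k A.π A.isProjectiveOver
  let A'' : ProjModel k K := ofModification A ρ P hPne hprojρ
  let ψρ : A''.Hom A := ofModificationHom A ρ P hPne hprojρ
  have hψρf : ψρ.f = ρ := rfl
  have hregX' : ∀ y : X', ρ y ∈ (U : Set A.X) → IsRegularLocalRing (X'.presheaf.stalk y) := by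
    intro y hy
    obtain ⟨s', rfl⟩ := hover y (by rwa [Scheme.Opens.range_ι])
    haveI := hregS' s'
    exact IsRegularLocalRing.of_ringEquiv (asIso (j'.stalkMap s')).commRingCatIsoToRingEquiv.symm
  /- (7) the transported rational map on `X'`, defined over `j'(S')` -/
  haveI : IsDominant ρ := ψρ.isDominant
  let z' : Fin (n + 1) → X'.functionField := fun l => RatFn.functionFieldMap ρ (z l)
  have hz'eq : z' = fun l => A''.funFieldAlgEquiv.symm (w l) :=
    funext fun l => functionFieldMap_funFieldIso_inv ψρ (w l)
  have hdef' : ∀ s' : S', IsDefinedAt z' (j' s') := by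
    intro s'
    refine isDefinedAt_of_isLocallyPrincipalAt_comap ρ hz'
      (isLocallyPrincipalAt_of_comap_isOpenImmersion j' _ ?_)
    have h := hprinc s'
    have hJσ : J.comap σ = ((baseIdeal z).comap ρ).comap j' := by
      change ((baseIdeal z).comap U.ι).comap σ = _
      rw [← Scheme.IdealSheafData.comap_comp, ← Scheme.IdealSheafData.comap_comp, hpb.w]
    rwa [hJσ] at h
  /- (8) the open `W` of definition; the join `Y = J(A'', B)` is `A''` over `W` -/
  have hz'' : ∃ i, z' i ≠ 0 := by
    obtain ⟨i, hi⟩ := hz'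
    exact ⟨i, (map_ne_zero _).mpr hi⟩
  let W : X'.Opens := ⟨{y | IsDefinedAt z' y}, by
    have h := (isClosed_setOf_not_isDefinedAt hz'').isOpen_compl
    rwa [Set.compl_setOf, funext fun x => propext not_not] at h⟩
  have hWne : (W : Set X').Nonempty := ⟨j' (Classical.arbitrary S'), hdef' _⟩
  have hWdef : ∀ y ∈ W, IsDefinedAt (fun l => A''.funFieldAlgEquiv.symm (w l)) y :=
    fun y hy => by rw [← hz'eq]; exact hy
  have hisoW : IsIso ((joinFst A'' B).f ∣_ W) :=
    isIso_joinFst_morphismRestrict_of_isDefinedAt A'' B ιB hιBw w hw hgenB W hWne hWdef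
  /- (9) `Y` is `B` over `η⁻¹(P)` -/
  let VB : B.X.Opens := η.f ⁻¹ᵁ P
  have hηξ : η.f (genericPoint B.X) = genericPoint A.X := by
    rw [← B.genericPt_eq, ← Scheme.Hom.comp_apply, η.gen_f, A.genericPt_eq]
  have hVBne : (VB : Set B.X).Nonempty :=
    ⟨genericPoint B.X, show η.f (genericPoint B.X) ∈ P from hηξ ▸ A.genericPoint_mem hPne⟩
  let f₁ : (VB : Scheme.{u}) ⟶ A''.X := (η.f ∣_ P) ≫ invOver A ρ P
  have hf₁ : f₁ ≫ A''.π = VB.ι ≫ B.π := by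
    change ((η.f ∣_ P) ≫ invOver A ρ P) ≫ ρ ≫ A.π = VB.ι ≫ B.π
    rw [Category.assoc, invOver_ρ_assoc, ← Category.assoc, morphismRestrict_ι, Category.assoc,
      η.f_π]
  let sB : Spec (CommRingCat.of K) ⟶ VB := B.genLift hVBne
  have h₂B : sB ≫ VB.ι = B.gen := B.genLift_ι hVBne
  have hsBP : sB ≫ (η.f ∣_ P) = A.genLift hPne := by
    rw [← cancel_mono P.ι, Category.assoc, morphismRestrict_ι, ← Category.assoc, h₂B, η.gen_f,
      genLift_ι]
  have h₁B : sB ≫ f₁ = A''.gen := by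
    change sB ≫ (η.f ∣_ P) ≫ invOver A ρ P = A.genLift hPne ≫ invOver A ρ P
    rw [← Category.assoc, hsBP]
  have hisoB : IsIso ((joinSnd A'' B).f ∣_ VB) := isIso_joinSnd_morphismRestrict VB f₁ hf₁ sB h₂B h₁B
  /- (10) conclusion -/
  have hcommf : (joinSnd A'' B).f ≫ η.f = (joinFst A'' B).f ≫ ρ := by
    have h := congrArg KModel.Hom.f (Hom.eq ((joinSnd A'' B).comp η) ((joinFst A'' B).comp ψρ))
    simpa only [Hom.comp_f, hψρf] using h
  have hcomm : ∀ y : (join A'' B).X,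
      η.f ((joinSnd A'' B).f y) = ρ ((joinFst A'' B).f y) := fun y => by
    rw [← Scheme.Hom.comp_apply, hcommf, Scheme.Hom.comp_apply]
    rfl
  have hregW : ∀ y : (join A'' B).X, ρ ((joinFst A'' B).f y) ∈ (U : Set A.X) →
      IsRegularLocalRing ((join A'' B).X.presheaf.stalk y) := by
    intro y hyU
    have hyW : (joinFst A'' B).f y ∈ W := by
      obtain ⟨s', hs'⟩ := hover _ (by rwa [Scheme.Opens.range_ι])
      change IsDefinedAt z' ((joinFst A'' B).f y)
      rw [← hs']
      exact hdef' s'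
    haveI : IsRegularLocalRing (A''.X.presheaf.stalk ((joinFst A'' B).f y)) := hregX' _ hyU
    haveI := isIso_stalkMap_of_isIso_morphismRestrict (joinFst A'' B).f W y hyW
    exact IsRegularLocalRing.of_ringEquiv
      (asIso ((joinFst A'' B).f.stalkMap y)).commRingCatIsoToRingEquiv
  refine ⟨join A'' B, (joinFst A'' B).comp ψρ, joinSnd A'' B, fun y hy => ?_, fun y hy => ?_⟩
  · rw [Hom.comp_f, Scheme.Hom.comp_apply, hψρf] at hy
    exact hregW y hy
  · by_cases haU : ρ ((joinFst A'' B).f y) ∈ (U : Set A.X)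
    · exact hregW y haU
    · have haP : η.f ((joinSnd A'' B).f y) ∈ P := by
        rw [hcomm]; exact hPsing _ haU
      haveI : IsRegularLocalRing (B.X.presheaf.stalk ((joinSnd A'' B).f y)) := hy
      haveI := isIso_stalkMap_of_isIso_morphismRestrict (joinSnd A'' B).f VB y haP
      exact IsRegularLocalRing.of_ringEquiv
        (asIso ((joinSnd A'' B).f.stalkMap y)).commRingCatIsoToRingEquiv

/-- **Zariski–Piltant patching, Step 5** (Piltant 2013, proof of Prop. 5.1, Step 5, for
`P = P_reg`), the case `U₂ = Reg A` stated with the fundamental locus `F_η` of `η⁻¹` (which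
contains the indeterminacy locus, `not_hasCentre_subset_fundamentalLocus`): if the closure of
`F_η ∩ Reg A` stays inside `Reg A` and every non-zero ideal sheaf on `Reg A` is principalized by
blowing ups along regular centres in the non-locally-principal loci, there is a projective model
`Y` dominating `A` and `B` with `ψ_A⁻¹(Reg A) ⊆ Reg Y` and `ψ_B⁻¹(Reg B) ⊆ Reg Y`.
[cite: Piltant2013, Prop. 5.1 (proof, Step 5)] -/
theorem exists_regLe_pair_of_closure_fundamentalLocus_subset (A B : ProjModel k K) (η : B.Hom A)
    (hPr : ∀ (U : A.X.Opens), (U : Set A.X) = Scheme.regularLocus A.X →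
      ∀ J : (U : Scheme.{u}).IdealSheafData, J ≠ ⊥ →
        ∃ (S' : Scheme.{u}) (σ : S' ⟶ U), IsRegularCentreBlowupSeq σ J ∧
          IsLocallyPrincipal (J.comap σ))
    (hnb : closure ((η.f.fundamentalLocus : Set A.X) ∩ Scheme.regularLocus A.X) ⊆
      Scheme.regularLocus A.X) :
    ∃ (Y : ProjModel k K) (ψA : Y.Hom A) (ψB : Y.Hom B), ψA.RegLe ∧ ψB.RegLe := by
  have hqe : Scheme.IsQuasiExcellent A.X :=
    (Scheme.isExcellent_of_locallyOfFiniteType Stacks07QW_field_holds A.π).isQuasiExcellent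
  obtain ⟨U, hU⟩ := Scheme.exists_opens_coe_eq_regularLocus hqe
  have hUne : (U : Set A.X).Nonempty := by
    rw [hU]; exact (Scheme.dense_regularLocus A.X).nonempty
  have hnb' : closure ({a : A.X | ¬ B.HasCentre (A.stalkSubring a)} ∩ (U : Set A.X)) ⊆ U := by
    rw [hU]
    refine (closure_mono ?_).trans hnb
    exact Set.inter_subset_inter_left _ (not_hasCentre_subset_fundamentalLocus A B η)
  obtain ⟨Y, ψA, ψB, hA, hB⟩ :=
    exists_regLe_pair_of_closure_subset A B η U hU.le hUne (hPr U hU) hnb'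
  refine ⟨Y, ψA, ψB, fun y hy => hA y ?_, hB⟩
  change ψA.f y ∈ (U : Set A.X)
  rw [hU]; exact hy

/-- **Step 5 in dimension three from Cossart–Piltant's principalization** (Axiom 4 :=
`CossartPiltant2019Principalization` on `Reg A`, `regPrincipalization_of_principalization`).
[cite: Piltant2013, Prop. 5.1 (proof, Step 5)] -/
theorem exists_regLe_pair_of_principalization (hP : CossartPiltant2019Principalization.{u})
    (A B : ProjModel k K) (η : B.Hom A) (hdim : topologicalKrullDim A.X = 3)
    (hnb : closure ((η.f.fundamentalLocus : Set A.X) ∩ Scheme.regularLocus A.X) ⊆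
      Scheme.regularLocus A.X) :
    ∃ (Y : ProjModel k K) (ψA : Y.Hom A) (ψB : Y.Hom B), ψA.RegLe ∧ ψB.RegLe :=
  exists_regLe_pair_of_closure_fundamentalLocus_subset A B η
    (regPrincipalization_of_principalization hP A hdim) hnb

end ProjModel

end Literature.AlgebraicGeometry.Resolution

end
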